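import Literature.MathematicalPhysics.QuantumManyBody.LangevinGenerator
import Mathlib.Analysis.Calculus.FDeriv.Symmetric
import HarnessLib

/-!
# Complex-valued directional calculus on the `N`-particle torus

Topic `Literature/MathematicalPhysics/QuantumManyBody`; companion of `LangevinGenerator.lean`
(real-valued `pderiv`, `integral_cellN_pderiv_eq_zero`) and `PeriodicBoseGasFourier.lean`
(plane waves `cellWave`). Infrastructure for sum-rule computations (f-sum rule, Puff's cubic
moment) on the torus `(ℝ³/Lℤ³)^N`, where one differentiates complex amplitudes along the
"density-wave" directions `Pi.single j w` (particle `j` moved along `w ∈ ℝ³`):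

* linearity of `v ↦ fderiv ℝ f X v` on `v = ∑_{j,c} v_{j,c} e_{j,c}`;
* product rules (two and three factors, linear combinations, finite sums, second order) in the
  applied form `fderiv ℝ (fun Y => …) X v = …`, and invariance of directional derivatives under a
  permutation symmetry of the function;
* symmetry of second directional derivatives of `C²` functions in the form
  `∂_v (∂_u f) = ∂_u (∂_v f)` (from `ContDiffAt.isSymmSndFDerivAt`), smoothness and periodicity of
  directional derivatives.

Periodic integration by parts and Green's identity for complex amplitudes are in the companion
`PeriodicTorusByParts.lean`. All statements are unbundled (`fderiv ℝ f X v`), no new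
definitions. All `[folklore]`.
-/

noncomputable section

open MeasureTheory
open scoped ENNReal NNReal ComplexConjugate

namespace Literature.MathematicalPhysics.QuantumManyBody.BoseGas

variable {N : ℕ}

/-! ### Linearity in the direction -/

/-- Expansion of a vector of `(ℝ³)^N` in the coordinate unit vectors `e_{j,c}`:
`v = ∑ⱼ ∑_c v_{j,c} e_{j,c}` (local copy of the expansion in
`GroundStateFeynmanKacDisplacement.lean`, not imported to keep this file light). [folklore] -/
private theorem config_eq_sum_smul_single_aux (v : Config N) :
    v = ∑ j : Fin N, ∑ c : Fin 3, v j c • (Pi.single j (EuclideanSpace.single c (1 : ℝ)) : Config N) := by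
  funext i
  rw [Finset.sum_apply, Finset.sum_eq_single i (fun j _ hj => ?_) (fun h => absurd (Finset.mem_univ i) h)]
  · rw [Finset.sum_apply]
    simp only [Pi.smul_apply, Pi.single_eq_same]
    conv_lhs => rw [← (EuclideanSpace.basisFun (Fin 3) ℝ).sum_repr (v i)]
    simp [EuclideanSpace.basisFun_apply]
  · rw [Finset.sum_apply]
    simp [Pi.single_eq_of_ne hj.symm]

/-- Linearity of the directional derivative in the direction:
`Df(X)·v = ∑ⱼ ∑_c v_{j,c} Df(X)·e_{j,c}`. [folklore] -/
theorem fderiv_apply_eq_sum {F : Type*} [NormedAddCommGroup F] [NormedSpace ℝ F]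
    (f : Config N → F) (X v : Config N) :
    fderiv ℝ f X v =
      ∑ j : Fin N, ∑ c : Fin 3, v j c • fderiv ℝ f X (Pi.single j (EuclideanSpace.single c (1 : ℝ))) := by
  conv_lhs => rw [config_eq_sum_smul_single_aux v]
  rw [map_sum]
  refine Finset.sum_congr rfl fun j _ => ?_
  rw [map_sum]
  exact Finset.sum_congr rfl fun c _ => by rw [map_smul]

/-- The special case of a single particle: `Df(X)·(Pi.single j w) = ∑_c w_c Df(X)·e_{j,c}`.
[folklore] -/
theorem fderiv_apply_single_eq_sum {F : Type*} [NormedAddCommGroup F] [NormedSpace ℝ F]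
    (f : Config N → F) (X : Config N) (j : Fin N) (w : Space) :
    fderiv ℝ f X (Pi.single j w) =
      ∑ c : Fin 3, w c • fderiv ℝ f X (Pi.single j (EuclideanSpace.single c (1 : ℝ))) := by
  rw [fderiv_apply_eq_sum, Finset.sum_eq_single j (fun i _ hi => ?_)
    (fun h => absurd (Finset.mem_univ j) h)]
  · simp only [Pi.single_eq_same]
  · simp [Pi.single_eq_of_ne hi]

/-! ### Real and imaginary parts, real amplitudes -/

section Parts

variable {G : Config N → ℂ} {u : Config N → ℝ} {X v : Config N}

/-- `Re` of a directional derivative is the directional derivative of `Re`. [folklore] -/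
theorem fderiv_re_apply (hG : DifferentiableAt ℝ G X) (v : Config N) :
    fderiv ℝ (fun Y => (G Y).re) X v = (fderiv ℝ G X v).re := by
  have h : HasFDerivAt (fun Y => (G Y).re) (Complex.reCLM.comp (fderiv ℝ G X)) X :=
    Complex.reCLM.hasFDerivAt.comp X hG.hasFDerivAt
  rw [h.fderiv]
  rfl

/-- `Im` of a directional derivative is the directional derivative of `Im`. [folklore] -/
theorem fderiv_im_apply (hG : DifferentiableAt ℝ G X) (v : Config N) :
    fderiv ℝ (fun Y => (G Y).im) X v = (fderiv ℝ G X v).im := by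
  have h : HasFDerivAt (fun Y => (G Y).im) (Complex.imCLM.comp (fderiv ℝ G X)) X :=
    Complex.imCLM.hasFDerivAt.comp X hG.hasFDerivAt
  rw [h.fderiv]
  rfl

/-- `conj` commutes with directional derivatives. [folklore] -/
theorem fderiv_conj_apply (hG : DifferentiableAt ℝ G X) (v : Config N) :
    fderiv ℝ (fun Y => conj (G Y)) X v = conj (fderiv ℝ G X v) := by
  have h : HasFDerivAt (fun Y => conj (G Y))
      ((Complex.conjCLE : ℂ →L[ℝ] ℂ).comp (fderiv ℝ G X)) X :=
    Complex.conjCLE.hasFDerivAt.comp X hG.hasFDerivAt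
  rw [h.fderiv]
  rfl

/-- The derivative of a real amplitude viewed in `ℂ` is real: `D(u : ℂ)(X)·v = (Du(X)·v : ℂ)`.
[folklore] -/
theorem fderiv_ofReal_apply (hu : DifferentiableAt ℝ u X) (v : Config N) :
    fderiv ℝ (fun Y => ((u Y : ℝ) : ℂ)) X v = ((fderiv ℝ u X v : ℝ) : ℂ) := by
  have h : HasFDerivAt (fun Y => ((u Y : ℝ) : ℂ)) (Complex.ofRealCLM.comp (fderiv ℝ u X)) X :=
    Complex.ofRealCLM.hasFDerivAt.comp X hu.hasFDerivAt
  rw [h.fderiv]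
  rfl

/-- A real amplitude viewed in `ℂ` is differentiable where the amplitude is. [folklore] -/
theorem differentiableAt_ofReal_comp (hu : DifferentiableAt ℝ u X) :
    DifferentiableAt ℝ (fun Y => ((u Y : ℝ) : ℂ)) X := by
  have h : HasFDerivAt (fun Y => ((u Y : ℝ) : ℂ)) (Complex.ofRealCLM.comp (fderiv ℝ u X)) X :=
    Complex.ofRealCLM.hasFDerivAt.comp X hu.hasFDerivAt
  exact h.differentiableAt

/-- A `Cⁿ` real amplitude viewed in `ℂ` is `Cⁿ`. [folklore] -/
theorem contDiff_ofReal_comp {n : WithTop ℕ∞} (hu : ContDiff ℝ n u) :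
    ContDiff ℝ n (fun Y => ((u Y : ℝ) : ℂ)) :=
  Complex.ofRealCLM.contDiff.comp hu

end Parts

/-! ### Smoothness and periodicity of directional derivatives -/

section Deriv

variable {F : Type*} [NormedAddCommGroup F] [NormedSpace ℝ F] {f : Config N → F} {L : ℝ}

/-- For `f ∈ C^{n+1}`, the directional derivative `Y ↦ Df(Y)·v` is `Cⁿ`. [folklore] -/
theorem contDiff_fderiv_apply_const {n : WithTop ℕ∞} (hf : ContDiff ℝ (n + 1) f) (v : Config N) :
    ContDiff ℝ n (fun Y => fderiv ℝ f Y v) :=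
  (hf.fderiv_right le_rfl).clm_apply contDiff_const

/-- For `f ∈ C¹`, `Y ↦ Df(Y)·v` is continuous. [folklore] -/
theorem continuous_fderiv_apply_const (hf : ContDiff ℝ 1 f) (v : Config N) :
    Continuous (fun Y => fderiv ℝ f Y v) :=
  (hf.continuous_fderiv one_ne_zero).clm_apply continuous_const

/-- **Directional derivatives of periodic functions are periodic** (differentiate
`f(· + L e_{i,c}) = f`). [folklore] -/
theorem fderiv_apply_periodic
    (hper : ∀ (X : Config N) (i : Fin N) (c : Fin 3),
      f (X + Pi.single i (EuclideanSpace.single c L)) = f X)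
    (v X : Config N) (i : Fin N) (c : Fin 3) :
    fderiv ℝ f (X + Pi.single i (EuclideanSpace.single c L)) v = fderiv ℝ f X v := by
  have h : (fun Y => f (Y + Pi.single i (EuclideanSpace.single c L))) = f :=
    funext fun Y => hper Y i c
  rw [← fderiv_comp_add_right, h]

/-- **Second directional derivatives of a `C²` function commute**:
`∂_v(∂_u f) = ∂_u(∂_v f)` (symmetry of the second Fréchet derivative over `ℝ`). [folklore] -/
theorem fderiv_fderiv_apply_comm (hf : ContDiff ℝ 2 f) (X u v : Config N) :
    fderiv ℝ (fun Y => fderiv ℝ f Y u) X v = fderiv ℝ (fun Y => fderiv ℝ f Y v) X u := by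
  have hd : DifferentiableAt ℝ (fderiv ℝ f) X :=
    ((hf.fderiv_right (m := 1) (by norm_num)).differentiable one_ne_zero) X
  have h1 : fderiv ℝ (fun Y => fderiv ℝ f Y u) X v = fderiv ℝ (fderiv ℝ f) X v u := by
    rw [fderiv_clm_apply hd (differentiableAt_const u)]; simp
  have h2 : fderiv ℝ (fun Y => fderiv ℝ f Y v) X u = fderiv ℝ (fderiv ℝ f) X u v := by
    rw [fderiv_clm_apply hd (differentiableAt_const v)]; simp
  rw [h1, h2]
  exact (hf.contDiffAt.isSymmSndFDerivAt (by simp)) v u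

end Deriv


/-! ### Product rules in applied form -/

section Algebra

variable {F G H : Config N → ℂ} {X : Config N}

/-- Product rule `∂_v(FG) = (∂_v F) G + F (∂_v G)`, applied form. [folklore] -/
theorem fderiv_mul_apply (hF : DifferentiableAt ℝ F X) (hG : DifferentiableAt ℝ G X) (v : Config N) :
    fderiv ℝ (fun Y => F Y * G Y) X v = fderiv ℝ F X v * G X + F X * fderiv ℝ G X v := by
  rw [fderiv_fun_mul hF hG]
  simp only [FunLike.coe_add, FunLike.coe_smul, Pi.add_apply, Pi.smul_apply, smul_eq_mul]
  ring

/-- `∂_v(F + G) = ∂_v F + ∂_v G`. [folklore] -/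
theorem fderiv_add_apply' (hF : DifferentiableAt ℝ F X) (hG : DifferentiableAt ℝ G X)
    (v : Config N) :
    fderiv ℝ (fun Y => F Y + G Y) X v = fderiv ℝ F X v + fderiv ℝ G X v := by
  rw [fderiv_fun_add hF hG]
  rfl

/-- `∂_v(c F) = c ∂_v F` for a complex constant `c`. [folklore] -/
theorem fderiv_const_mul_apply' (hF : DifferentiableAt ℝ F X) (c : ℂ) (v : Config N) :
    fderiv ℝ (fun Y => c * F Y) X v = c * fderiv ℝ F X v := by
  rw [fderiv_const_mul hF c]
  rfl

/-- `∂_v(c₁ F + c₂ G) = c₁ ∂_v F + c₂ ∂_v G`. [folklore] -/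
theorem fderiv_lincomb_apply (hF : DifferentiableAt ℝ F X) (hG : DifferentiableAt ℝ G X)
    (c₁ c₂ : ℂ) (v : Config N) :
    fderiv ℝ (fun Y => c₁ * F Y + c₂ * G Y) X v = c₁ * fderiv ℝ F X v + c₂ * fderiv ℝ G X v := by
  rw [fderiv_add_apply' (hF.const_mul c₁) (hG.const_mul c₂), fderiv_const_mul_apply' hF,
    fderiv_const_mul_apply' hG]

/-- `∂_v(c₁ F + c₂ G + c₃ H) = c₁ ∂_v F + c₂ ∂_v G + c₃ ∂_v H`. [folklore] -/
theorem fderiv_lincomb₃_apply (hF : DifferentiableAt ℝ F X) (hG : DifferentiableAt ℝ G X)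
    (hH : DifferentiableAt ℝ H X) (c₁ c₂ c₃ : ℂ) (v : Config N) :
    fderiv ℝ (fun Y => c₁ * F Y + c₂ * G Y + c₃ * H Y) X v =
      c₁ * fderiv ℝ F X v + c₂ * fderiv ℝ G X v + c₃ * fderiv ℝ H X v := by
  have h12 : DifferentiableAt ℝ (fun Y => c₁ * F Y + c₂ * G Y) X :=
    (hF.const_mul c₁).add (hG.const_mul c₂)
  rw [fderiv_add_apply' h12 (hH.const_mul c₃), fderiv_lincomb_apply hF hG,
    fderiv_const_mul_apply' hH]

/-- Triple product rule `∂_v(FGH) = (∂_v F)GH + F(∂_v G)H + FG(∂_v H)`. [folklore] -/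
theorem fderiv_mul₃_apply (hF : DifferentiableAt ℝ F X) (hG : DifferentiableAt ℝ G X)
    (hH : DifferentiableAt ℝ H X) (v : Config N) :
    fderiv ℝ (fun Y => F Y * G Y * H Y) X v =
      fderiv ℝ F X v * G X * H X + F X * fderiv ℝ G X v * H X + F X * G X * fderiv ℝ H X v := by
  have hFG : DifferentiableAt ℝ (fun Y => F Y * G Y) X := hF.mul hG
  rw [fderiv_mul_apply hFG hH, fderiv_mul_apply hF hG]
  ring

/-- Derivative of a finite sum, applied form. [folklore] -/
theorem fderiv_finset_sum_apply {ι : Type*} (s : Finset ι) {E' : Type*} [NormedAddCommGroup E']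
    [NormedSpace ℝ E'] {A : ι → Config N → E'} (h : ∀ i ∈ s, DifferentiableAt ℝ (A i) X)
    (v : Config N) :
    fderiv ℝ (fun Y => ∑ i ∈ s, A i Y) X v = ∑ i ∈ s, fderiv ℝ (A i) X v := by
  rw [fderiv_fun_sum h, FunLike.coe_sum, Finset.sum_apply]

end Algebra

/-! ### Second order -/

section SecondOrder

variable {E' : Type*} [NormedAddCommGroup E'] [NormedSpace ℝ E'] {f : Config N → E'}
  {F G : Config N → ℂ}

/-- For `f ∈ C²`, `Y ↦ Df(Y)·v` is `C¹`. [folklore] -/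
theorem contDiff_one_fderiv_apply_const (hf : ContDiff ℝ 2 f) (v : Config N) :
    ContDiff ℝ 1 (fun Y => fderiv ℝ f Y v) :=
  (hf.fderiv_right (m := 1) (by norm_num)).clm_apply contDiff_const

/-- For `f ∈ C³`, `Y ↦ Df(Y)·v` is `C²`. [folklore] -/
theorem contDiff_two_fderiv_apply_const (hf : ContDiff ℝ 3 f) (v : Config N) :
    ContDiff ℝ 2 (fun Y => fderiv ℝ f Y v) :=
  (hf.fderiv_right (m := 2) (by norm_num)).clm_apply contDiff_const

/-- For `f ∈ C²`, `Y ↦ Df(Y)·v` is differentiable. [folklore] -/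
theorem differentiable_fderiv_apply_const (hf : ContDiff ℝ 2 f) (v : Config N) :
    Differentiable ℝ (fun Y => fderiv ℝ f Y v) :=
  (contDiff_one_fderiv_apply_const hf v).differentiable one_ne_zero

/-- Second derivative of a finite sum of `C²` functions, applied form. [folklore] -/
theorem fderiv_fderiv_finset_sum_apply {ι : Type*} (s : Finset ι) {A : ι → Config N → E'}
    (h : ∀ i ∈ s, ContDiff ℝ 2 (A i)) (X u v : Config N) :
    fderiv ℝ (fun Y => fderiv ℝ (fun Z => ∑ i ∈ s, A i Z) Y u) X v =
      ∑ i ∈ s, fderiv ℝ (fun Y => fderiv ℝ (A i) Y u) X v := by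
  have h1 : (fun Y => fderiv ℝ (fun Z => ∑ i ∈ s, A i Z) Y u) =
      fun Y => ∑ i ∈ s, fderiv ℝ (A i) Y u :=
    funext fun Y => fderiv_finset_sum_apply s
      (fun i hi => (h i hi).differentiable two_ne_zero Y) u
  rw [h1]
  exact fderiv_finset_sum_apply s
    (fun i hi => differentiable_fderiv_apply_const (h i hi) u X) v

/-- **Second-order Leibniz rule** along a direction:
`∂_v∂_v(FG) = (∂_v∂_v F)G + 2 ∂_vF ∂_vG + F ∂_v∂_v G`. [folklore] -/
theorem fderiv_fderiv_mul_apply (hF : ContDiff ℝ 2 F) (hG : ContDiff ℝ 2 G) (X v : Config N) :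
    fderiv ℝ (fun Y => fderiv ℝ (fun Z => F Z * G Z) Y v) X v =
      fderiv ℝ (fun Y => fderiv ℝ F Y v) X v * G X + 2 * (fderiv ℝ F X v * fderiv ℝ G X v) +
        F X * fderiv ℝ (fun Y => fderiv ℝ G Y v) X v := by
  have hFd := hF.differentiable two_ne_zero
  have hGd := hG.differentiable two_ne_zero
  have h1 : (fun Y => fderiv ℝ (fun Z => F Z * G Z) Y v) =
      fun Y => fderiv ℝ F Y v * G Y + F Y * fderiv ℝ G Y v :=
    funext fun Y => fderiv_mul_apply (hFd Y) (hGd Y) v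
  have hA : DifferentiableAt ℝ (fun Y => fderiv ℝ F Y v * G Y) X :=
    (differentiable_fderiv_apply_const hF v X).mul (hGd X)
  have hB : DifferentiableAt ℝ (fun Y => F Y * fderiv ℝ G Y v) X :=
    (hFd X).mul (differentiable_fderiv_apply_const hG v X)
  rw [h1, fderiv_add_apply' hA hB,
    fderiv_mul_apply (differentiable_fderiv_apply_const hF v X) (hGd X),
    fderiv_mul_apply (hFd X) (differentiable_fderiv_apply_const hG v X)]
  ring

/-- Second derivative of a linear combination of two real `C²` amplitudes viewed in `ℂ`. [folklore] -/
theorem fderiv_fderiv_lincomb_ofReal_apply {f g : Config N → ℝ} (hf : ContDiff ℝ 2 f)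
    (hg : ContDiff ℝ 2 g) (c₁ c₂ : ℂ) (X u v : Config N) :
    fderiv ℝ (fun Y => fderiv ℝ (fun Z => c₁ * ((f Z : ℝ) : ℂ) + c₂ * ((g Z : ℝ) : ℂ)) Y u) X v =
      c₁ * ((fderiv ℝ (fun Y => fderiv ℝ f Y u) X v : ℝ) : ℂ) +
        c₂ * ((fderiv ℝ (fun Y => fderiv ℝ g Y u) X v : ℝ) : ℂ) := by
  have hfd := hf.differentiable two_ne_zero
  have hgd := hg.differentiable two_ne_zero
  have h1 : (fun Y => fderiv ℝ (fun Z => c₁ * ((f Z : ℝ) : ℂ) + c₂ * ((g Z : ℝ) : ℂ)) Y u) =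
      fun Y => c₁ * ((fderiv ℝ f Y u : ℝ) : ℂ) + c₂ * ((fderiv ℝ g Y u : ℝ) : ℂ) := by
    funext Y
    rw [fderiv_lincomb_apply (differentiableAt_ofReal_comp (hfd Y))
      (differentiableAt_ofReal_comp (hgd Y)), fderiv_ofReal_apply (hfd Y),
      fderiv_ofReal_apply (hgd Y)]
  rw [h1, fderiv_lincomb_apply
      (differentiableAt_ofReal_comp (differentiable_fderiv_apply_const hf u X))
      (differentiableAt_ofReal_comp (differentiable_fderiv_apply_const hg u X)),
    fderiv_ofReal_apply (differentiable_fderiv_apply_const hf u X),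
    fderiv_ofReal_apply (differentiable_fderiv_apply_const hg u X)]

end SecondOrder

/-! ### Permutation symmetry -/

section Perm

variable {E' : Type*} [NormedAddCommGroup E'] [NormedSpace ℝ E'] {f : Config N → E'}

/-- **Derivatives of a permutation-symmetric function**: if `f(Y ∘ σ) = f(Y)` for all `Y`, then
`Df(X ∘ σ)·(v ∘ σ) = Df(X)·v`. [folklore] -/
theorem fderiv_comp_perm_apply (hf : Differentiable ℝ f) (σ : Equiv.Perm (Fin N))
    (hsymm : ∀ Y : Config N, f (Y ∘ σ) = f Y) (X v : Config N) :
    fderiv ℝ f (X ∘ σ) (v ∘ σ) = fderiv ℝ f X v := by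
  set T : Config N →L[ℝ] Config N :=
    ContinuousLinearMap.pi fun i => ContinuousLinearMap.proj (σ i) with hT
  have hTapp : ∀ Y : Config N, T Y = Y ∘ σ := fun Y => rfl
  have h1 : HasFDerivAt (fun Y : Config N => f (Y ∘ σ)) ((fderiv ℝ f (X ∘ σ)).comp T) X := by
    have h := (hf (X ∘ σ)).hasFDerivAt.comp X T.hasFDerivAt
    exact h
  have h2 : (fun Y : Config N => f (Y ∘ σ)) = f := funext hsymm
  rw [h2] at h1
  rw [h1.fderiv, ContinuousLinearMap.comp_apply, hTapp]

/-- For a permutation-symmetric `f`: `Df(X ∘ σ)·(Pi.single j w) = Df(X)·(Pi.single (σ j) w)`.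
[folklore] -/
theorem fderiv_comp_perm_apply_single (hf : Differentiable ℝ f) (σ : Equiv.Perm (Fin N))
    (hsymm : ∀ Y : Config N, f (Y ∘ σ) = f Y) (X : Config N) (j : Fin N) (w : Space) :
    fderiv ℝ f (X ∘ σ) (Pi.single j w) = fderiv ℝ f X (Pi.single (σ j) w) := by
  have h : (Pi.single (σ j) w : Config N) ∘ σ = Pi.single j w := by
    funext i
    simp only [Function.comp_apply, Pi.single_apply, σ.injective.eq_iff]
  rw [← fderiv_comp_perm_apply hf σ hsymm X (Pi.single (σ j) w), h]

end Perm


end Literature.MathematicalPhysics.QuantumManyBody.BoseGas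

end
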